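import Literature.AlgebraicGeometry.ModuliOfAbelianVarieties.SiegelAdmissibleClassUnique
import Literature.NumberTheory.ModularForms.SiegelUpperHalfSpaceLevelCovering
import HarnessLib

/-!
# Two admissible markings of ONE Siegel triple differ by a UNIQUE element of `Γ_δ(N)`, which is their rational representation;
# at one period point they COINCIDE ([Milne 2005] Thm. 6.11 + Lemma 5.13 with Serre's lemma; [Lange 2023] Prop. 3.1.4, Rem. 3.1.10)

Topic `Literature/AlgebraicGeometry/ModuliOfAbelianVarieties`; namespace `Literature.AlgebraicGeometry.ModuliOfAbelianVarieties`.
THEOREMS ONLY (no definition, no named fact, no instance, no `sorry`); the (U) fact file is imported (via ★ `SiegelAdmissibleClassUnique`)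
for the predicate currency only — `siegelModuli_complexUniformisation` is NOT assumed.  Cell `hodgecm-mathlib` (D-0151), programme P6,
E-line organ E6 of crux hLiu418 (stmt-HodgeConjecture-24832), ROAD MAP v2 step 5∕6 items «MRK-UNIQ» ∕ «MRK-TRANSPORT» (consumer: the E6
closer՚s definition of the `𝒪_F`-action `y_b` through THE admissible marking of a fibre).  HONEST LABEL: HC_CM is proved only modulo the
2 remaining named inputs (hLiu418 24832, h413 24833) until rung 0 closes; this file is count-neutral.

THE MATHEMATICS.  Let `B → S` be an abelian scheme with a dual pair `D`, a homomorphism `λ : B → B̂` and a level-`N` structure `φ` (`N ≥ 3`),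
`s : Spec ℂ → S` a complex point (for a triple `P′` over `Spec ℂ`: `B = P′.A`, `λ = P′.pol.lam`, `s = 𝟙` — the setting of ★ `IsAdmissibleAt`; for
the E6 closer: the fibre of the PEL family at a complex point of the curve), `r ∈ K_δ(1)`, and `(m, Θ, Λ)`, `(m′, Θ′, Λ′)` two ADMISSIBILITY DATA
of the fibre `B_s` at `(Z, r)`, `(Z′, r)` (a T1′ marking by `[J(Z), r]`, an `IsLambdaOfAt` witness, a symplectic lift of `φ` at `s` matched to the
marking՚s torsion tower read through `r`).  For a triple ★ `SiegelAdmissibleClassUnique` proves `[J(Z), rK_δ(N)] = [J(Z′), rK_δ(N)]` by showing that the rational representation `q` of `𝟙_A` between the two markings (`u(v) = u′(q v)`,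
★ `SiegelAdelicMarking.exists_ratRep_of_hom`) lies in `Γ_δ(N) = GSp_δ(ℚ) ∩ K_δ(N)` with `q·J(Z)·q⁻¹ = J(Z′)` — and then FORGETS `q`.  This file keeps it:

* §1 `exists_siegelLevelGroup_smul_ratRep_of_lifts` — **there is `M ∈ Γ_δ(N)` with `Z′ = M • Z` (Möbius action through Lange՚s `G_D`,
  ★ `gDHom`) AND `u(v) = u′(M_ℚ v)` for all `v ∈ ℚ^{2g}`**: the Möbius element relating the two period points IS the rational representation
  relating the two torsion parametrisations (steps (1)–(5) of ★ `siegelShimuraSet_mk_eq_of_isAdmissibleAt`, then ★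
  `exists_siegelLevelGroup_map_eq_of_mem_principalLevelSubgroup`, ★ `conjAct_map_intCast_jOfSiegel`, ★ `jOfSiegel_coe_injective`);
* §2 MRK-UNIQ `SiegelAdelicMarking.r_eq_r_of_lifts` — **at ONE period point (`Z′ = Z`) the two torsion parametrisations COINCIDE,
  `u = u′` on `ℚ^{2g}`**: `Γ_δ(N)`, `N ≥ 3`, acts FREELY on `𝔥_g` (Minkowski ∕ «lemma of Serre», ★ `SiegelModuli.isCancelSMul_levelGD`), so `M = 1`;
  and `SiegelAdelicMarking.toFun_proj_eq_of_lifts` — hence the two REAL uniformisations `x ↦ toFun [γ⁻¹ x]`, `x ↦ toFun′ [γ′⁻¹ x]` of `A(ℂ)` by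
  `ℝ^{2g} = V_ℝ` coincide (density of `ℚ^{2g}`, continuity);
* §3 MRK-TRANSPORT `SiegelAdelicMarking.r_mulVec_eq_r_of_lifts_of_smul` — **if `Z′ = M • Z` for a GIVEN `M ∈ Γ_δ(N)`, the admissible marking at
  `(Z′, r)` READS `u′(M_ℚ v) = u(v)`** (the «`M`-translate» of `u`): the `M` of §1 is unique by the free action.

[Milne2005ShimuraVarieties] Thm. 6.11 + Lemma 5.13 fn. 40 («we find that `q ∈ Γ`») + torsion-freeness of `Γ(N)`, `N ≥ 3` ([Lange2023AbelianVarietiesComplex]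
Remark 3.1.10 (2); [MumfordFogartyKirwan1994] Ch. 7 §3 «lemma of Serre»): a level-`N` structure with `N ≥ 3` RIGIDIFIES the marking.

## References
* [Milne2005ShimuraVarieties] J. S. Milne, *Introduction to Shimura Varieties* (2005; rev. 2017), §6 Thm. 6.11 pp. 74–75, Lemma 5.13 p. 57 (fn. 40).
* [Lange2023AbelianVarietiesComplex] H. Lange, *Abelian Varieties over the Complex Numbers* (2023), §3.1.2 Prop. 3.1.4, §3.1.3 Remark 3.1.10 (2).
* [MumfordFogartyKirwan1994] D. Mumford, J. Fogarty, F. Kirwan, *Geometric Invariant Theory*, 3rd ed., Ch. 7 §3 (lemma of Serre), App. 7A.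
* [Deligne1971TravauxShimura] P. Deligne, *Travaux de Shimura* (1971), 4.12 (b) p. 149, 4.16 p. 150.
-/

set_option autoImplicit false

noncomputable section

open Matrix CategoryTheory AlgebraicGeometry Topology
open Literature.AlgebraicGeometry.Motives (AbelianVariety AlgPoints CartierDivisor)
open Literature.AlgebraicGeometry.AbelianSchemes (AbelianSchemeOver)
open Literature.NumberTheory.Adeles (latticeOfGL mem_latticeOfGL_one_iff latticeOfGL_mul_eq_of_mem integralAdeleResidue)
open Literature.NumberTheory.Automorphic (siegelUpperHalfSpace)
open Literature.Geometry.Kaehler (ComplexTorus)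

namespace Literature.AlgebraicGeometry.ModuliOfAbelianVarieties

open SiegelModuli

variable {g : ℕ} {δ : Fin g → ℕ}

/-! ### §0. An elementary lemma (private twin of the helper of ★ `SiegelAdmissibleClassUnique`) -/

/-- A rational matrix carrying EVERY rational vector to an integer vector is zero. [folklore] -/
private theorem eq_zero_of_forall_mulVec_int {n : Type*} [Fintype n] [DecidableEq n] (D : Matrix n n ℚ)
    (h : ∀ v : n → ℚ, ∀ i, ∃ z : ℤ, (z : ℚ) = (D *ᵥ v) i) : D = 0 := by
  ext i j
  rw [Matrix.zero_apply]
  by_contra hne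
  obtain ⟨z, hz⟩ := h (Pi.single j (1 / (2 * D i j))) i
  rw [Matrix.mulVec, dotProduct_single] at hz
  have h2 : (((2 * z : ℤ)) : ℚ) = 1 := by
    push_cast
    rw [hz]
    field_simp
  norm_cast at h2
  omega

/-! ### §1. The Möbius element between two admissibility data IS their rational representation -/

section Core

variable {N : ℕ} {S : Scheme} {B : AbelianSchemeOver S} {s : Spec (CommRingCat.of ℂ) ⟶ S} {D : B.DualPair} {lam : B.X ⟶ D.hat.X}
  {φ : B.LevelStructure g N} {Θ Θ' : CartierDivisor (B.fibre s).toAbelianVariety.X.left}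
  {r : gspFinAdelic δ} {Z Z' : Matrix (Fin g) (Fin g) ℂ}

set_option maxHeartbeats 800000 in -- as ★ `siegelShimuraSet_mk_eq_of_isAdmissibleAt` (adelic ∕ torsion-tower bookkeeping)
/-- **The Möbius element of `Γ_δ(N)` relating two admissibility data of ONE fibre is their rational representation** ([Milne2005ShimuraVarieties]
Thm. 6.11 injectivity ∕ Lemma 5.13, read WITHOUT forgetting `q`): for `0 < g`, a polarisation type `δ`, `N ≥ 3`, an integral representative
`r ∈ K_δ(1)`, `Z, Z′ ∈ 𝔥_g`, the fibre at a complex point `s` of an abelian scheme `B → S` with `(D, λ, φ)` and admissibility data `(m, Θ, Λ)` at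
`(Z, r)`, `(m′, Θ′, Λ′)` at `(Z′, r)` (markings, `IsLambdaOfAt` witnesses, matched symplectic lifts — the body of ★ `IsAdmissibleAt`), there is `M ∈ Γ_δ(N)` with
`Z′ = gDHom M • Z` AND `u(v) = u′(M_ℚ v)` for every `v ∈ ℚ^{2g}`.  Proof: steps (1)–(5) of ★ `siegelShimuraSet_mk_eq_of_isAdmissibleAt` produce the
rational representation `q` of `𝟙` (★ `exists_ratRep_of_hom`), integral and `≡ 1 (mod N)` (★ `exists_intMatrix_of_ratRep_of_lifts`), a rational
similitude (★ `smul_transpose_mul_typeForm_mul_eq_of_lifts` + ★ `IsLambdaOfAt.weilPairingLevel_eq`) with `q̂ ∈ K_δ(N)` and `q·J(Z)·q⁻¹ = J(Z′)`; then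
`GSp_δ(ℚ) ∩ K_δ(N) = Γ_δ(N)` (★ `exists_siegelLevelGroup_map_eq_of_mem_principalLevelSubgroup`) and the equivariance `M_ℚ·J(Z) = J(gDHom M • Z)` (★
`conjAct_map_intCast_jOfSiegel`, ★ `jOfSiegel_coe_injective`).
[cite: Milne2005ShimuraVarieties, §6 Thm. 6.11 pp. 74–75; Lemma 5.13 p. 57 (footnote 40)] [cite: Lange2023AbelianVarietiesComplex, §3.1.2 Prop. 3.1.4]
[cite: Deligne1971TravauxShimura, 4.16 p. 150] -/
theorem exists_siegelLevelGroup_smul_ratRep_of_lifts (hg : 0 < g) (hδ : IsPolarizationType δ) (hN : 3 ≤ N)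
    (hr : r ∈ principalLevelSubgroup δ 1) (hZ : Z ∈ siegelUpperHalfSpace g) (hZ' : Z' ∈ siegelUpperHalfSpace g)
    (m : SiegelAdelicMarking ⟨jOfSiegel δ Z, SiegelComplexRecordSystem.jOfSiegel_mem_C0pm hδ.1 hZ⟩ r (B.fibre s).toAbelianVariety)
    (Λ : φ.SymplecticLift s Θ δ) (hΘl : B.IsLambdaOfAt s D lam Θ)
    (hΛ : ∀ ⦃M : ℕ⦄, N ∣ M → M ≠ 0 → ∀ (x : Fin g ⊕ Fin g → ZMod M) (v : Fin g ⊕ Fin g → ℚ),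
      AdelicCongr ((r⁻¹ : gspFinAdelic δ) : GL (Fin g ⊕ Fin g) finAdeleQ) 1 v (fun i => ((x i).val : ℚ) / M) →
        ((Λ.lift M (Multiplicative.ofAdd x)) : (B.fibre s).toAbelianVariety.Points ℂ) = m.r v)
    (m' : SiegelAdelicMarking ⟨jOfSiegel δ Z', SiegelComplexRecordSystem.jOfSiegel_mem_C0pm hδ.1 hZ'⟩ r (B.fibre s).toAbelianVariety)
    (Λ' : φ.SymplecticLift s Θ' δ) (hΘl' : B.IsLambdaOfAt s D lam Θ')
    (hΛ' : ∀ ⦃M : ℕ⦄, N ∣ M → M ≠ 0 → ∀ (x : Fin g ⊕ Fin g → ZMod M) (v : Fin g ⊕ Fin g → ℚ),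
      AdelicCongr ((r⁻¹ : gspFinAdelic δ) : GL (Fin g ⊕ Fin g) finAdeleQ) 1 v (fun i => ((x i).val : ℚ) / M) →
        ((Λ'.lift M (Multiplicative.ofAdd x)) : (B.fibre s).toAbelianVariety.Points ℂ) = m'.r v) :
    ∃ M : symplecticLatticeGroup δ, (M : GL (Fin g ⊕ Fin g) ℤ) ∈ siegelLevelGroup δ N ∧
      (⟨Z', hZ'⟩ : siegelUpperHalfSpace g) = gDHom δ hδ.1 M • ⟨Z, hZ⟩ ∧
      ∀ v : Fin g ⊕ Fin g → ℚ,
        m.r v = m'.r ((((M : GL (Fin g ⊕ Fin g) ℤ) : Matrix (Fin g ⊕ Fin g) (Fin g ⊕ Fin g) ℤ).map (Int.castRingHom ℚ)) *ᵥ v) := by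
  -- adapted from ★ `SiegelAdmissibleClassUnique.siegelShimuraSet_mk_eq_of_isAdmissibleAt` (steps (1)–(5) verbatim; the end keeps `q`)
  have hN0 : N ≠ 0 := by omega
  haveI : NeZero N := ⟨hN0⟩
  have hN1 : 1 < N := by omega
  -- (1) the rational representations of `𝟙` between the two markings, in both directions
  obtain ⟨q, hq0, hqJ⟩ := m.exists_ratRep_of_hom m' (𝟙 _)
  obtain ⟨q', hq0', -⟩ := m'.exists_ratRep_of_hom m (𝟙 _)
  have hq : ∀ v, m.r v = m'.r (q *ᵥ v) := fun v => by
    have h := hq0 v; simp only [AbelianVariety.id_hom] at h; exact h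
  have hq' : ∀ v, m'.r v = m.r (q' *ᵥ v) := fun v => by
    have h := hq0' v; simp only [AbelianVariety.id_hom] at h; exact h
  -- (2) integrality: `q, q′ ∈ 1 + N·M_{2g}(ℤ)`
  obtain ⟨Q, hQq, hQ1⟩ := exists_intMatrix_of_ratRep_of_lifts hδ hg hN1 hr Λ m hΛ Λ' m' hΛ' hq
  obtain ⟨Q', hQ'q, hQ'1⟩ := exists_intMatrix_of_ratRep_of_lifts hδ hg hN1 hr Λ' m' hΛ' Λ m hΛ hq'
  have hlat := latticeOfGL_coe_eq_one_of_mem_principalLevelSubgroup_one hr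
  have hq'q : q' * q = 1 := by
    rw [← sub_eq_zero]
    refine eq_zero_of_forall_mulVec_int _ fun v => ?_
    have h1 : m.r (q' *ᵥ (q *ᵥ v)) = m.r v := by rw [← hq', ← hq]
    have h2 := (m.r_eq_r_iff_sub_mem_latticeOfGL _ _).1 h1
    rw [hlat, mem_latticeOfGL_one_iff] at h2
    simpa only [Matrix.sub_mulVec, Matrix.one_mulVec, ← Matrix.mulVec_mulVec] using h2
  have hqq' : q * q' = 1 := by
    rw [← sub_eq_zero]
    refine eq_zero_of_forall_mulVec_int _ fun v => ?_
    have h1 : m'.r (q *ᵥ (q' *ᵥ v)) = m'.r v := by rw [← hq, ← hq']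
    have h2 := (m'.r_eq_r_iff_sub_mem_latticeOfGL _ _).1 h1
    rw [hlat, mem_latticeOfGL_one_iff] at h2
    simpa only [Matrix.sub_mulVec, Matrix.one_mulVec, ← Matrix.mulVec_mulVec] using h2
  set qGL : GL (Fin g ⊕ Fin g) ℚ := ⟨q, q', hqq', hq'q⟩ with hqGL
  -- (3) `q` is a rational similitude of `E_δ`
  have hpair : ∀ ⦃M : ℕ⦄
      [IsDominant (AbelianVariety.Hom.toSchemeHom (((M : ℕ) : ℤ) • 𝟙 (B.fibre s).toAbelianVariety))]
      (P₁ P₂ : (B.fibre s).toAbelianVariety.torsionPoints ℂ (M : ℤ)),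
      (B.fibre s).toAbelianVariety.weilPairingLevel Θ P₁ P₂ = (B.fibre s).toAbelianVariety.weilPairingLevel Θ' P₁ P₂ :=
    fun M _ P₁ P₂ => AbelianSchemeOver.IsLambdaOfAt.weilPairingLevel_eq B D lam s hΘl hΘl' P₁ P₂
  have hqQ : ∀ v, m.r v = m'.r (Q.map (Int.castRingHom ℚ) *ᵥ v) := by rw [hQq]; exact hq
  have hF := smul_transpose_mul_typeForm_mul_eq_of_lifts hδ hg hN0 hr Λ m hΛ Λ' m' hΛ' hpair hqQ
  set d : ℤ := typeForm δ (Sum.inl ⟨0, hg⟩) (Sum.inr ⟨0, hg⟩) with hd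
  set F : Matrix (Fin g ⊕ Fin g) (Fin g ⊕ Fin g) ℤ := Qᵀ * typeForm δ * Q with hFdef
  have hd0 : d ≠ 0 := by
    rw [hd, typeForm, Matrix.fromBlocks_apply₁₂, Matrix.diagonal_apply_eq]
    exact Nat.cast_ne_zero.2 (hδ.1 ⟨0, hg⟩).ne'
  have hQQ' : Q * Q' = 1 := by
    have hinj : Function.Injective (fun X : Matrix (Fin g ⊕ Fin g) (Fin g ⊕ Fin g) ℤ => X.map (Int.castRingHom ℚ)) :=
      fun X Y hXY => by
        ext i j
        have := congrFun (congrFun hXY i) j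
        simpa using this
    apply hinj
    simp only [Matrix.map_mul, hQq, hQ'q, hqq', Matrix.map_one (Int.castRingHom ℚ) (map_zero _) (map_one _)]
  have hdetQ : Q.det ≠ 0 := fun h0 => by
    have := congrArg Matrix.det hQQ'
    rw [Matrix.det_mul, h0, zero_mul, Matrix.det_one] at this; exact zero_ne_one this
  have hdetE : (typeForm δ).det ≠ 0 := fun h0 => by
    apply det_typeFormOver_rat_ne_zero hδ.1
    rw [typeFormOver, ← RingHom.mapMatrix_apply, ← RingHom.map_det, h0, map_zero]
  have hF0 : F (Sum.inl ⟨0, hg⟩) (Sum.inr ⟨0, hg⟩) ≠ 0 := by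
    intro h0
    rw [h0, zero_smul, smul_eq_zero] at hF
    rcases hF with h1 | h1
    · exact hd0 h1
    · haveI : Nonempty (Fin g ⊕ Fin g) := ⟨Sum.inl ⟨0, hg⟩⟩
      have := congrArg Matrix.det h1
      rw [Matrix.det_mul, Matrix.det_mul, Matrix.det_transpose, Matrix.det_zero] at this
      exact mul_ne_zero (mul_ne_zero hdetQ hdetE) hdetQ this
  set ν : ℚ := (F (Sum.inl ⟨0, hg⟩) (Sum.inr ⟨0, hg⟩) : ℚ) / d with hν
  have hν0 : ν ≠ 0 := div_ne_zero (Int.cast_ne_zero.2 hF0) (Int.cast_ne_zero.2 hd0)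
  have hdQ : (d : ℚ) ≠ 0 := Int.cast_ne_zero.2 hd0
  have hsim : IsMultiplier (typeFormOver δ ℚ) qGL (Units.mk0 ν hν0) := by
    rw [isMultiplier_iff, Units.val_mk0]
    change qᵀ * typeFormOver δ ℚ * q = ν • typeFormOver δ ℚ
    rw [← hQq, typeFormOver, ← Matrix.transpose_map, ← Matrix.map_mul, ← Matrix.map_mul]
    ext i j
    have hij := congrFun (congrFun hF i) j
    simp only [Matrix.smul_apply, smul_eq_mul] at hij
    rw [Matrix.map_apply, Matrix.smul_apply, Matrix.map_apply, smul_eq_mul, hν, eq_intCast, eq_intCast,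
      div_mul_eq_mul_div, eq_div_iff hdQ]
    exact_mod_cast (mul_comm _ _).trans hij
  set γ : gspRational δ := ⟨qGL, Units.mk0 ν hν0, hsim⟩ with hγ
  -- (4) `q̂, q̂⁻¹ ≡ 1 (mod N)`: the adelic point of `q` lies in `K_δ(N)`
  have hK : gspRationalToFinAdelic δ γ ∈ principalLevelSubgroup δ N := by
    rw [mem_principalLevelSubgroup_iff]
    constructor
    · have e : (((gspRationalToFinAdelic δ γ : gspFinAdelic δ) : GL (Fin g ⊕ Fin g) finAdeleQ) :
          Matrix (Fin g ⊕ Fin g) (Fin g ⊕ Fin g) finAdeleQ) = Q.map (Int.castRingHom finAdeleQ) := by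
        rw [coe_gspRationalToFinAdelic, ← map_intCast_map_algebraMap Q, hQq]; rfl
      rw [e]; exact (isCongOne_map_intCast_iff hN0 Q).2 hQ1
    · have e : ((((gspRationalToFinAdelic δ γ : gspFinAdelic δ) : GL (Fin g ⊕ Fin g) finAdeleQ)⁻¹ :
          GL (Fin g ⊕ Fin g) finAdeleQ) : Matrix (Fin g ⊕ Fin g) (Fin g ⊕ Fin g) finAdeleQ) =
          Q'.map (Int.castRingHom finAdeleQ) := by
        rw [coe_gspRationalToFinAdelic, ← map_inv, ← map_intCast_map_algebraMap Q', hQ'q]; rfl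
      rw [e]; exact (isCongOne_map_intCast_iff hN0 Q').2 hQ'1
  -- (5) `q · J(Z) · q⁻¹ = J(Z′)`
  have hconj : conjAct δ (gspRationalToReal δ γ)
      ⟨jOfSiegel δ Z, SiegelComplexRecordSystem.jOfSiegel_mem_C0pm hδ.1 hZ⟩ =
      ⟨jOfSiegel δ Z', SiegelComplexRecordSystem.jOfSiegel_mem_C0pm hδ.1 hZ'⟩ := by
    apply Subtype.ext
    rw [coe_conjAct, conjJ_def]
    have e1 : (((gspRationalToReal δ γ : gspReal δ) : GL (Fin g ⊕ Fin g) ℝ) :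
        Matrix (Fin g ⊕ Fin g) (Fin g ⊕ Fin g) ℝ) = q.map (algebraMap ℚ ℝ) := rfl
    have e2 : (((gspRationalToReal δ γ : gspReal δ) : GL (Fin g ⊕ Fin g) ℝ) :
          Matrix (Fin g ⊕ Fin g) (Fin g ⊕ Fin g) ℝ) *
        ((((gspRationalToReal δ γ : gspReal δ) : GL (Fin g ⊕ Fin g) ℝ)⁻¹ : GL (Fin g ⊕ Fin g) ℝ) :
          Matrix (Fin g ⊕ Fin g) (Fin g ⊕ Fin g) ℝ) = 1 := by
      rw [← Units.val_mul, mul_inv_cancel, Units.val_one]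
    rw [e1] at e2 ⊢
    rw [hqJ, Matrix.mul_assoc, e2, Matrix.mul_one]
  -- (6) NEW ENDING: `GSp_δ(ℚ) ∩ K_δ(N) = Γ_δ(N)`: `q = M_ℚ` for an `M ∈ Γ_δ(N)`, and `M_ℚ · J(Z) = J(gDHom M • Z)`
  obtain ⟨M, hM, hMγ⟩ := exists_siegelLevelGroup_map_eq_of_mem_principalLevelSubgroup hδ hg hN γ hK
  have hγM : γ = ⟨Matrix.GeneralLinearGroup.map (Int.castRingHom ℚ) M,
      map_mem_gspRational_of_mem_symplecticLatticeGroup δ hM.1⟩ := Subtype.ext hMγ.symm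
  -- `q = M_ℚ` as matrices
  have hqM : ((M : Matrix (Fin g ⊕ Fin g) (Fin g ⊕ Fin g) ℤ)).map (Int.castRingHom ℚ) = q :=
    congrArg (fun u : GL (Fin g ⊕ Fin g) ℚ => (u : Matrix (Fin g ⊕ Fin g) (Fin g ⊕ Fin g) ℚ)) hMγ
  -- `Z′ = gDHom M • Z`
  rw [hγM] at hconj
  have h2 := (conjAct_map_intCast_jOfSiegel hδ.1 ⟨M, hM.1⟩ ⟨Z, hZ⟩).symm.trans hconj
  have hZZ' : gDHom δ hδ.1 ⟨M, hM.1⟩ • (⟨Z, hZ⟩ : siegelUpperHalfSpace g) = (⟨Z', hZ'⟩ : siegelUpperHalfSpace g) :=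
    jOfSiegel_coe_injective hδ.1 (Z := gDHom δ hδ.1 ⟨M, hM.1⟩ • (⟨Z, hZ⟩ : siegelUpperHalfSpace g))
      (Z' := (⟨Z', hZ'⟩ : siegelUpperHalfSpace g)) (congrArg Subtype.val h2)
  refine ⟨⟨M, hM.1⟩, hM, hZZ'.symm, fun v => ?_⟩
  rw [hq v, ← hqM]

/-- **The Möbius element of §1 is UNIQUE** — `Γ_δ(N)`, `N ≥ 3`, acts freely on `𝔥_g` (Minkowski's lemma ∕ the «lemma of Serre», ★
`SiegelModuli.isCancelSMul_levelGD`): two elements of `Γ_δ(N)` moving `Z` to the same point are equal.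
[cite: Lange2023AbelianVarietiesComplex, §3.1.3 Remark 3.1.10 (2) (p0162)] [cite: MumfordFogartyKirwan1994, Ch. 7 §3 (lemma of Serre)] -/
theorem eq_of_gDHom_smul_eq_gDHom_smul (hδ : IsPolarizationType δ) (hN : 3 ≤ N) {M M' : symplecticLatticeGroup δ}
    (hM : (M : GL (Fin g ⊕ Fin g) ℤ) ∈ siegelLevelGroup δ N) (hM' : (M' : GL (Fin g ⊕ Fin g) ℤ) ∈ siegelLevelGroup δ N)
    (W : siegelUpperHalfSpace g) (h : gDHom δ hδ.1 M • W = gDHom δ hδ.1 M' • W) : M = M' := by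
  have hmem : gDHom δ hδ.1 (M'⁻¹ * M) ∈ levelGD δ N hδ.1 :=
    Subgroup.mem_map.2 ⟨M'⁻¹ * M, (Subgroup.mem_subgroupOf).2
      ((siegelLevelGroup δ N).mul_mem ((siegelLevelGroup δ N).inv_mem hM') hM), rfl⟩
  have hfix : (⟨gDHom δ hδ.1 (M'⁻¹ * M), hmem⟩ : levelGD δ N hδ.1) • W = W := by
    rw [Subgroup.smul_def, Subgroup.coe_mk, map_mul, map_inv, mul_smul, h, inv_smul_smul]
  haveI := Literature.NumberTheory.ModularForms.SiegelUpperHalfSpace.isCancelSMul_levelGD (δ := δ) hδ.1 hN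
  have h1 : (⟨gDHom δ hδ.1 (M'⁻¹ * M), hmem⟩ : levelGD δ N hδ.1) = 1 := IsCancelSMul.eq_one_of_smul hfix
  have h2 : gDHom δ hδ.1 (M'⁻¹ * M) = 1 := congrArg Subtype.val h1
  have h3 : M'⁻¹ * M = 1 := Literature.NumberTheory.ModularForms.SiegelUpperHalfSpace.gDHom_injective hδ.1 (by rw [h2, map_one])
  exact (inv_mul_eq_one.1 h3).symm

end Core

/-! ### §2. MRK-UNIQ: at ONE period point the two admissible markings coincide -/

section Uniq

variable {N : ℕ} {S : Scheme} {B : AbelianSchemeOver S} {s : Spec (CommRingCat.of ℂ) ⟶ S} {D : B.DualPair} {lam : B.X ⟶ D.hat.X}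
  {φ : B.LevelStructure g N} {Θ Θ' : CartierDivisor (B.fibre s).toAbelianVariety.X.left}
  {r : gspFinAdelic δ} {Z : Matrix (Fin g) (Fin g) ℂ}

/-- **MRK-UNIQ — two admissibility data of one fibre at the SAME `(Z, r)` have the same torsion parametrisation: `u = u′` on `ℚ^{2g}`**
([Milne2005ShimuraVarieties] Thm. 6.11 with Lemma 5.13 and the torsion-freeness of `Γ(N)`, `N ≥ 3`): by §1 `u(v) = u′(M_ℚ v)` with
`M ∈ Γ_δ(N)` FIXING `Z`, and `Γ_δ(N)` acts freely on `𝔥_g` (★ `SiegelModuli.isCancelSMul_levelGD`), so `M = 1`.  The level-`N` structure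
RIGIDIFIES the marking: no automorphism of `(A, λ, η)` survives ([MumfordFogartyKirwan1994] Ch. 7 §3, lemma of Serre).
[cite: Milne2005ShimuraVarieties, §6 Thm. 6.11 pp. 74–75; Lemma 5.13 p. 57] [cite: Lange2023AbelianVarietiesComplex, §3.1.3 Remark 3.1.10 (2)]
[cite: MumfordFogartyKirwan1994, Ch. 7 §3 (lemma of Serre)] -/
theorem SiegelAdelicMarking.r_eq_r_of_lifts (hg : 0 < g) (hδ : IsPolarizationType δ) (hN : 3 ≤ N)
    (hr : r ∈ principalLevelSubgroup δ 1) (hZ : Z ∈ siegelUpperHalfSpace g)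
    (m : SiegelAdelicMarking ⟨jOfSiegel δ Z, SiegelComplexRecordSystem.jOfSiegel_mem_C0pm hδ.1 hZ⟩ r (B.fibre s).toAbelianVariety)
    (Λ : φ.SymplecticLift s Θ δ) (hΘl : B.IsLambdaOfAt s D lam Θ)
    (hΛ : ∀ ⦃M : ℕ⦄, N ∣ M → M ≠ 0 → ∀ (x : Fin g ⊕ Fin g → ZMod M) (v : Fin g ⊕ Fin g → ℚ),
      AdelicCongr ((r⁻¹ : gspFinAdelic δ) : GL (Fin g ⊕ Fin g) finAdeleQ) 1 v (fun i => ((x i).val : ℚ) / M) →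
        ((Λ.lift M (Multiplicative.ofAdd x)) : (B.fibre s).toAbelianVariety.Points ℂ) = m.r v)
    (m' : SiegelAdelicMarking ⟨jOfSiegel δ Z, SiegelComplexRecordSystem.jOfSiegel_mem_C0pm hδ.1 hZ⟩ r (B.fibre s).toAbelianVariety)
    (Λ' : φ.SymplecticLift s Θ' δ) (hΘl' : B.IsLambdaOfAt s D lam Θ')
    (hΛ' : ∀ ⦃M : ℕ⦄, N ∣ M → M ≠ 0 → ∀ (x : Fin g ⊕ Fin g → ZMod M) (v : Fin g ⊕ Fin g → ℚ),
      AdelicCongr ((r⁻¹ : gspFinAdelic δ) : GL (Fin g ⊕ Fin g) finAdeleQ) 1 v (fun i => ((x i).val : ℚ) / M) →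
        ((Λ'.lift M (Multiplicative.ofAdd x)) : (B.fibre s).toAbelianVariety.Points ℂ) = m'.r v)
    (v : Fin g ⊕ Fin g → ℚ) : m.r v = m'.r v := by
  obtain ⟨M, hM, hZZ, hq⟩ := exists_siegelLevelGroup_smul_ratRep_of_lifts hg hδ hN hr hZ hZ m Λ hΘl hΛ m' Λ' hΘl' hΛ'
  have hM1 : M = 1 :=
    eq_of_gDHom_smul_eq_gDHom_smul hδ hN hM (siegelLevelGroup δ N).one_mem ⟨Z, hZ⟩ (by rw [map_one, one_smul]; exact hZZ.symm)
  rw [hq v, hM1]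
  simp only [OneMemClass.coe_one, Units.val_one, Matrix.map_one (Int.castRingHom ℚ) (map_zero _) (map_one _), Matrix.one_mulVec]

/-- **MRK-UNIQ for the REAL uniformisations**: under the hypotheses of `SiegelAdelicMarking.r_eq_r_of_lifts` the two analytic uniformisations of
`B_s(ℂ)` by `V_ℝ = ℝ^{2g}` — `x ↦ toFun [γ⁻¹ x]` and `x ↦ toFun′ [γ′⁻¹ x]` (lattice coordinates through the two rational frames `γ, γ′`) —
COINCIDE: they are continuous (★ `IsAnalytification` is a homeomorphism onto `A(ℂ)`, Hausdorff) and agree on the dense `ℚ^{2g}` (`r_eq_r_of_lifts`,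
★ `SiegelAdelicMarking.r_def`).  This is the form in which «the admissible marking of a fibre is THE marking» is consumed fibrewise.
[cite: Milne2005ShimuraVarieties, §6 Thm. 6.11 pp. 74–75] [cite: Lange2023AbelianVarietiesComplex, §3.1.3 Remark 3.1.10 (2)] -/
theorem SiegelAdelicMarking.toFun_proj_eq_of_lifts (hg : 0 < g) (hδ : IsPolarizationType δ) (hN : 3 ≤ N)
    (hr : r ∈ principalLevelSubgroup δ 1) (hZ : Z ∈ siegelUpperHalfSpace g)
    (m : SiegelAdelicMarking ⟨jOfSiegel δ Z, SiegelComplexRecordSystem.jOfSiegel_mem_C0pm hδ.1 hZ⟩ r (B.fibre s).toAbelianVariety)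
    (Λ : φ.SymplecticLift s Θ δ) (hΘl : B.IsLambdaOfAt s D lam Θ)
    (hΛ : ∀ ⦃M : ℕ⦄, N ∣ M → M ≠ 0 → ∀ (x : Fin g ⊕ Fin g → ZMod M) (v : Fin g ⊕ Fin g → ℚ),
      AdelicCongr ((r⁻¹ : gspFinAdelic δ) : GL (Fin g ⊕ Fin g) finAdeleQ) 1 v (fun i => ((x i).val : ℚ) / M) →
        ((Λ.lift M (Multiplicative.ofAdd x)) : (B.fibre s).toAbelianVariety.Points ℂ) = m.r v)
    (m' : SiegelAdelicMarking ⟨jOfSiegel δ Z, SiegelComplexRecordSystem.jOfSiegel_mem_C0pm hδ.1 hZ⟩ r (B.fibre s).toAbelianVariety)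
    (Λ' : φ.SymplecticLift s Θ' δ) (hΘl' : B.IsLambdaOfAt s D lam Θ')
    (hΛ' : ∀ ⦃M : ℕ⦄, N ∣ M → M ≠ 0 → ∀ (x : Fin g ⊕ Fin g → ZMod M) (v : Fin g ⊕ Fin g → ℚ),
      AdelicCongr ((r⁻¹ : gspFinAdelic δ) : GL (Fin g ⊕ Fin g) finAdeleQ) 1 v (fun i => ((x i).val : ℚ) / M) →
        ((Λ'.lift M (Multiplicative.ofAdd x)) : (B.fibre s).toAbelianVariety.Points ℂ) = m'.r v)
    (x : Fin g ⊕ Fin g → ℝ) :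
    m.toFun (ComplexTorus.proj m.Ψ
        ((((m.γ⁻¹ : GL (Fin g ⊕ Fin g) ℚ) : Matrix (Fin g ⊕ Fin g) (Fin g ⊕ Fin g) ℚ).map (algebraMap ℚ ℝ)) *ᵥ x)) =
      m'.toFun (ComplexTorus.proj m'.Ψ
        ((((m'.γ⁻¹ : GL (Fin g ⊕ Fin g) ℚ) : Matrix (Fin g ⊕ Fin g) (Fin g ⊕ Fin g) ℚ).map (algebraMap ℚ ℝ)) *ᵥ x)) := by
  -- both sides are continuous in `x` and agree on the dense rational vectors
  have hd : DenseRange (fun v : Fin g ⊕ Fin g → ℚ => fun i => (v i : ℝ)) := DenseRange.piMap fun _ => Rat.denseRange_cast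
  have hc : ∀ (mm : SiegelAdelicMarking ⟨jOfSiegel δ Z, SiegelComplexRecordSystem.jOfSiegel_mem_C0pm hδ.1 hZ⟩ r (B.fibre s).toAbelianVariety),
      Continuous fun y : Fin g ⊕ Fin g → ℝ => mm.toFun (ComplexTorus.proj mm.Ψ
        ((((mm.γ⁻¹ : GL (Fin g ⊕ Fin g) ℚ) : Matrix (Fin g ⊕ Fin g) (Fin g ⊕ Fin g) ℚ).map (algebraMap ℚ ℝ)) *ᵥ y)) :=
    fun mm => mm.isAnalytification.isHomeomorph.continuous.comp
      ((ComplexTorus.continuous_proj _).comp (continuous_const.matrix_mulVec continuous_id))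
  have hrat : ∀ (mm : SiegelAdelicMarking ⟨jOfSiegel δ Z, SiegelComplexRecordSystem.jOfSiegel_mem_C0pm hδ.1 hZ⟩ r (B.fibre s).toAbelianVariety)
      (v : Fin g ⊕ Fin g → ℚ),
      mm.toFun (ComplexTorus.proj mm.Ψ
        ((((mm.γ⁻¹ : GL (Fin g ⊕ Fin g) ℚ) : Matrix (Fin g ⊕ Fin g) (Fin g ⊕ Fin g) ℚ).map (algebraMap ℚ ℝ)) *ᵥ
          fun i => (v i : ℝ))) = mm.r v := by
    intro mm v
    rw [mm.r_def]
    congr 2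
    funext i
    exact (RingHom.map_mulVec (algebraMap ℚ ℝ) _ v i).symm
  refine congrFun (Continuous.ext_on hd (hc m) (hc m') ?_) x
  rintro _ ⟨v, rfl⟩
  change m.toFun _ = m'.toFun _
  rw [hrat m v, hrat m' v]
  exact SiegelAdelicMarking.r_eq_r_of_lifts hg hδ hN hr hZ m Λ hΘl hΛ m' Λ' hΘl' hΛ' v

end Uniq

/-! ### §3. MRK-TRANSPORT: the admissible marking at `(M • Z, r)` reads `u′ ∘ M_ℚ = u` -/

section Transport

variable {N : ℕ} {S : Scheme} {B : AbelianSchemeOver S} {s : Spec (CommRingCat.of ℂ) ⟶ S} {D : B.DualPair} {lam : B.X ⟶ D.hat.X}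
  {φ : B.LevelStructure g N} {Θ Θ' : CartierDivisor (B.fibre s).toAbelianVariety.X.left}
  {r : gspFinAdelic δ} {Z Z' : Matrix (Fin g) (Fin g) ℂ}

/-- **MRK-TRANSPORT — the admissible marking at the translated period point is the `M`-translate, as a READING**: if `(m, Θ, Λ)` is an
admissibility datum of the fibre `B_s` at `(Z, r)`, `(m′, Θ′, Λ′)` one at `(Z′, r)`, and `Z′ = gDHom M • Z` for a GIVEN `M ∈ Γ_δ(N)`, then
`u′(M_ℚ v) = u(v)` for every `v ∈ ℚ^{2g}` — the `M` of §1 is this `M` (free action, `eq_of_gDHom_smul_eq_gDHom_smul`).  With ★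
`conjAct_map_intCast_jOfSiegel` (`M_ℚ·J(Z) = J(gDHom M • Z)`) this is [Milne2005ShimuraVarieties] §6 p. 75 «the triple of `[x, a]` depends only on the
class» read backwards on one triple: translating the period point by `Γ_δ(N)` relabels THE marking by `M`.
[cite: Milne2005ShimuraVarieties, §6 Thm. 6.11 pp. 74–75; Lemma 5.13 p. 57] [cite: Lange2023AbelianVarietiesComplex, §3.1.2 Prop. 3.1.4, §3.1.3 Remark 3.1.10 (2)] -/
theorem SiegelAdelicMarking.r_mulVec_eq_r_of_lifts_of_smul (hg : 0 < g) (hδ : IsPolarizationType δ) (hN : 3 ≤ N)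
    (hr : r ∈ principalLevelSubgroup δ 1) (hZ : Z ∈ siegelUpperHalfSpace g) (hZ' : Z' ∈ siegelUpperHalfSpace g)
    (m : SiegelAdelicMarking ⟨jOfSiegel δ Z, SiegelComplexRecordSystem.jOfSiegel_mem_C0pm hδ.1 hZ⟩ r (B.fibre s).toAbelianVariety)
    (Λ : φ.SymplecticLift s Θ δ) (hΘl : B.IsLambdaOfAt s D lam Θ)
    (hΛ : ∀ ⦃M : ℕ⦄, N ∣ M → M ≠ 0 → ∀ (x : Fin g ⊕ Fin g → ZMod M) (v : Fin g ⊕ Fin g → ℚ),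
      AdelicCongr ((r⁻¹ : gspFinAdelic δ) : GL (Fin g ⊕ Fin g) finAdeleQ) 1 v (fun i => ((x i).val : ℚ) / M) →
        ((Λ.lift M (Multiplicative.ofAdd x)) : (B.fibre s).toAbelianVariety.Points ℂ) = m.r v)
    (m' : SiegelAdelicMarking ⟨jOfSiegel δ Z', SiegelComplexRecordSystem.jOfSiegel_mem_C0pm hδ.1 hZ'⟩ r (B.fibre s).toAbelianVariety)
    (Λ' : φ.SymplecticLift s Θ' δ) (hΘl' : B.IsLambdaOfAt s D lam Θ')
    (hΛ' : ∀ ⦃M : ℕ⦄, N ∣ M → M ≠ 0 → ∀ (x : Fin g ⊕ Fin g → ZMod M) (v : Fin g ⊕ Fin g → ℚ),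
      AdelicCongr ((r⁻¹ : gspFinAdelic δ) : GL (Fin g ⊕ Fin g) finAdeleQ) 1 v (fun i => ((x i).val : ℚ) / M) →
        ((Λ'.lift M (Multiplicative.ofAdd x)) : (B.fibre s).toAbelianVariety.Points ℂ) = m'.r v)
    (M : symplecticLatticeGroup δ) (hM : (M : GL (Fin g ⊕ Fin g) ℤ) ∈ siegelLevelGroup δ N)
    (hZZ' : (⟨Z', hZ'⟩ : siegelUpperHalfSpace g) = gDHom δ hδ.1 M • ⟨Z, hZ⟩) (v : Fin g ⊕ Fin g → ℚ) :
    m'.r ((((M : GL (Fin g ⊕ Fin g) ℤ) : Matrix (Fin g ⊕ Fin g) (Fin g ⊕ Fin g) ℤ).map (Int.castRingHom ℚ)) *ᵥ v) = m.r v := by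
  obtain ⟨M₁, hM₁, hZZ₁, hq⟩ :=
    exists_siegelLevelGroup_smul_ratRep_of_lifts hg hδ hN hr hZ hZ' m Λ hΘl hΛ m' Λ' hΘl' hΛ'
  cases eq_of_gDHom_smul_eq_gDHom_smul hδ hN hM₁ hM ⟨Z, hZ⟩ (hZZ₁.symm.trans hZZ')
  exact (hq v).symm

end Transport

end Literature.AlgebraicGeometry.ModuliOfAbelianVarieties

end
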